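import Summits.Parity.GeneralizedHardyLittlewood.Theorems.LeeYangFibresFibrationLemmaAveraging
import HarnessLib

/-!
# Fibration lemma (`DimOne → GeneralizedHardyLittlewood`), part 9b: the averaging estimate

Support file for the statement item `FibrationLemma : DimOne → GeneralizedHardyLittlewood`
(Green–Tao 2010, §1, remark after Conj. 1.2). Continuation of part 9a (`…Averaging`: the setting
`FibreSetting`, fibre lengths, heads, `avgError`): the analytic heart of the fibration lemma,

  `|∑_{w good} ℓ(w) ∏_{p≤x} β_p(Φ_w) - vol(K) ∏_{p≤x} β_p(Ψ)| ≤ avgError`   for all `x ≥ z`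

(`abs_fibreMainSum_sub_le`) and its limit form `x → ∞` (`abs_fibreMainSum_lim_sub_le`), by the
decomposition `∏_{p≤x} β_p(Φ_w) = H(w) · B · R(w)`, `∏_{p≤x} β_p(Ψ) = H̄ · B · R̄` (part 6):
`∑ ℓ H B R - vol H̄ B R̄ = B · [∑ ℓ H (R - 1) + (∑_{good} ℓ H - vol H̄) + vol H̄ (1 - R̄)]`, with
`R - 1 ≤ X e^X` small in `L¹` (part 8), `∑_w ℓ(w) H(w) ≈ ∑_{n ∈ K ∩ ℤ^{d+1}} H(n') ≈ vol(K) H̄`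
(periodicity of the head and equidistribution, part 5), and `R̄ - 1 ≤ (2t³/z) e^{2t³/z}`.
-/

noncomputable section

open Finset MeasureTheory Filter
open scoped Topology

namespace Summit.Parity.GeneralizedHardyLittlewood.Theorems

open Literature.NumberTheory.Sieve

variable {d t : ℕ}

namespace FibreSetting

variable (S : FibreSetting d t)

section Estimate

variable {z : ℕ} (hz : tailThreshold t S.L ≤ z) (hz2 : 2 ≤ z) (hNt : t * t < 2 * S.N + 1)
include hz hz2 hNt

/-- **The averaging estimate at finite level `x ≥ z`**:
`|∑_{w good} ℓ(w) ∏_{p≤x} β_p(Φ_w) - vol(K) ∏_{p≤x} β_p(Ψ)| ≤ avgError`.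
[cite: GreenTao2010, §1 (remark after Conj. 1.2)] -/
theorem abs_fibreMainSum_sub_le {x : ℕ} (hzx : z ≤ x) :
    |∑ w ∈ goodSet S.Ψ S.N, S.ell w * singularProductPartial (fibreSystem S.Ψ w) x -
        (volume S.K).toReal * singularProductPartial S.Ψ x| ≤ avgError d t S.L S.N z := by
  classical
  have hL := S.coeff_le
  have ha := S.lastCoeff_ne
  have ht := S.one_le_t
  have hd := S.one_le_d
  have hN := S.one_le_N
  have hc := S.const_le
  have hz1 : 1 ≤ z := by omega
  set D := discMax d S.L S.N with hD
  have hD1 : 1 ≤ D := by have := two_le_discMax S.one_le_L hN d; omega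
  obtain ⟨wstar, hwstar⟩ := S.goodSet_nonempty hNt
  have hMstar : ∀ i j, |(discForm S.Ψ i j).eval wstar| ≤ (D : ℕ) := fun i j =>
    abs_discForm_eval_le_discMax hL hc (goodSet_subset _ _ hwstar) i j
  -- abbreviations
  set B := tailB S.Ψ z x with hB
  set Rb := tailRbar S.Ψ z x with hRb
  set Hb := singularProductPartial S.Ψ z with hHb
  set V := (volume S.K).toReal with hV
  have hB0 : 0 ≤ B := tailB_nonneg _ _ _
  have hBle : B ≤ tailBound t D := tailB_le hL ha ht hz x hwstar hD1 hMstar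
  have hV0 : 0 ≤ V := ENNReal.toReal_nonneg
  have hHb0 : 0 ≤ Hb := singularProductPartial_nonneg _ _
  have hHbar : Hb ≤ headBar t S.L D := singularProductPartial_le_headBar hd hL ha ht hz hwstar hD1 hMstar
  have hRb1 : 1 ≤ Rb := one_le_tailRbar hL ha ht hz x
  have hRble : Rb ≤ Real.exp (2 * (t : ℝ) ^ 3 / z) := tailRbar_le_exp hd hL ha ht hz hz1 x
  -- rewrite both terms through the factorisation
  have hS : ∑ w ∈ goodSet S.Ψ S.N, S.ell w * singularProductPartial (fibreSystem S.Ψ w) x =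
      B * ∑ w ∈ goodSet S.Ψ S.N, S.ell w * S.head z w * tailR S.Ψ z x w := by
    rw [Finset.mul_sum]
    refine Finset.sum_congr rfl fun w _ => ?_
    rw [singularProductPartial_fibre_split hL ha ht hz hzx w, head]
    ring
  have hT : V * singularProductPartial S.Ψ x = B * (V * Hb * Rb) := by
    rw [singularProductPartial_split hL ha ht hz hzx]
    ring
  rw [hS, hT, ← mul_sub, abs_mul, abs_of_nonneg hB0]
  -- the bracket
  set G := goodSet S.Ψ S.N with hG
  have hdecomp : ∑ w ∈ G, S.ell w * S.head z w * tailR S.Ψ z x w - V * Hb * Rb =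
      ∑ w ∈ G, S.ell w * S.head z w * (tailR S.Ψ z x w - 1) +
        (∑ w ∈ G, S.ell w * S.head z w - V * Hb) - V * Hb * (Rb - 1) := by
    rw [Finset.sum_congr rfl fun w _ => mul_sub_one (S.ell w * S.head z w) (tailR S.Ψ z x w),
      Finset.sum_sub_distrib]
    ring
  -- Piece 1
  have hXsum := sum_goodSet_tailX_le hL ha hc ht hz hz1 hN x
  have hP1 : ∑ w ∈ G, S.ell w * S.head z w * (tailR S.Ψ z x w - 1) ≤
      2 * S.N * headMax t z * Real.exp (tailXmax t D z) *
        (2 * (t : ℝ) ^ 3 * (2 * S.N + 1 : ℝ) ^ (d - 1) * (2 * (D : ℝ) / z + Real.log (Real.log D) + 4)) := by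
    refine le_trans ?_ (mul_le_mul_of_nonneg_left hXsum (by
      have := headMax_nonneg t hz1; positivity))
    rw [Finset.mul_sum]
    refine Finset.sum_le_sum fun w hw => ?_
    have hR1 : 1 ≤ tailR S.Ψ z x w := one_le_tailR hL ha ht hz x w
    have hRX : tailR S.Ψ z x w ≤ Real.exp (tailX S.Ψ z x w) := tailR_le_exp_tailX hL ha ht hz x w
    have hX0 : 0 ≤ tailX S.Ψ z x w := tailX_nonneg ht hz x w
    have hXle : tailX S.Ψ z x w ≤ tailXmax t D z := tailX_le_tailXmax hL ha hc ht hz hz2 hN x hw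
    have h1 : tailR S.Ψ z x w - 1 ≤ tailX S.Ψ z x w * Real.exp (tailXmax t D z) :=
      calc tailR S.Ψ z x w - 1 ≤ Real.exp (tailX S.Ψ z x w) - 1 := by linarith
        _ ≤ tailX S.Ψ z x w * Real.exp (tailX S.Ψ z x w) := exp_sub_one_le_mul_exp _
        _ ≤ tailX S.Ψ z x w * Real.exp (tailXmax t D z) :=
            mul_le_mul_of_nonneg_left (Real.exp_le_exp.mpr hXle) hX0
    have hℓ := S.ell_le w
    have hℓ0 := S.ell_nonneg w
    obtain ⟨hH0, hH⟩ := S.head_le hz2 w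
    calc S.ell w * S.head z w * (tailR S.Ψ z x w - 1)
        ≤ (2 * S.N) * headMax t z * (tailX S.Ψ z x w * Real.exp (tailXmax t D z)) :=
          mul_le_mul (mul_le_mul hℓ hH hH0 (by positivity)) h1 (by linarith) (by
            have := headMax_nonneg t hz1; positivity)
      _ = 2 * S.N * headMax t z * Real.exp (tailXmax t D z) * tailX S.Ψ z x w := by ring
  -- Piece 2
  have hP2 : |∑ w ∈ G, S.ell w * S.head z w - V * Hb| ≤
      headMax t z * ((t * t * (2 * S.N + 1) ^ (d - 1) : ℕ) * (2 * S.N) + ((2 * S.N + 1) ^ d : ℕ) +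
        ((primorial z : ℕ) : ℝ) ^ d * (((d : ℝ) + 1) * 4 ^ d * ((2 * S.N : ℕ) : ℝ) ^ d)) := by
    have hsplit := sum_latticeBox_eq_sum_goodSet_add_sum_badSet S.Ψ S.N (fun w => S.ell w * S.head z w)
    have hequi := S.abs_sum_cnt_head_sub_le hz2
    -- `∑_G ℓH - V Hb = (∑_box c H - V Hb) + ∑_box (ℓ - c) H - ∑_bad ℓ H`
    have heq : ∑ w ∈ G, S.ell w * S.head z w - V * Hb =
        (∑ w ∈ latticeBox d S.N, (S.cnt w : ℝ) * S.head z w - V * Hb) +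
          ∑ w ∈ latticeBox d S.N, (S.ell w - S.cnt w) * S.head z w -
            ∑ w ∈ badSet S.Ψ S.N, S.ell w * S.head z w := by
      have h1 : ∑ w ∈ latticeBox d S.N, (S.ell w - S.cnt w) * S.head z w =
          ∑ w ∈ latticeBox d S.N, S.ell w * S.head z w -
            ∑ w ∈ latticeBox d S.N, (S.cnt w : ℝ) * S.head z w := by
        rw [← Finset.sum_sub_distrib]
        exact Finset.sum_congr rfl fun w _ => by ring
      rw [h1, hsplit, hG]
      ring
    rw [heq]
    have hbox : (#(latticeBox d S.N) : ℝ) = ((2 * S.N + 1) ^ d : ℕ) := by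
      have h1 : ((S.N : ℤ) + 1 - -(S.N : ℤ)) = ((2 * S.N + 1 : ℕ) : ℤ) := by push_cast; ring
      simp only [latticeBox, Fintype.card_piFinset, Int.card_Icc, Finset.prod_const, Finset.card_univ,
        Fintype.card_fin, h1, Int.toNat_natCast]
    have h2 : |∑ w ∈ latticeBox d S.N, (S.ell w - S.cnt w) * S.head z w| ≤ ((2 * S.N + 1) ^ d : ℕ) * headMax t z := by
      rw [← hbox]
      calc _ ≤ ∑ w ∈ latticeBox d S.N, |(S.ell w - S.cnt w) * S.head z w| := Finset.abs_sum_le_sum_abs _ _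
        _ ≤ ∑ _w ∈ latticeBox d S.N, headMax t z := Finset.sum_le_sum fun w _ => by
            rw [abs_mul]
            calc _ ≤ 1 * headMax t z := mul_le_mul (S.abs_ell_sub_cnt_le w) (S.abs_head_le hz2 w)
                  (abs_nonneg _) zero_le_one
              _ = headMax t z := one_mul _
        _ = _ := by rw [Finset.sum_const, nsmul_eq_mul]
    have h3 : |∑ w ∈ badSet S.Ψ S.N, S.ell w * S.head z w| ≤
        (t * t * (2 * S.N + 1) ^ (d - 1) : ℕ) * (2 * S.N) * headMax t z := by
      have hbad := card_badSet_le S.nondeg S.lastCoeff_ne S.N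
      calc _ ≤ ∑ w ∈ badSet S.Ψ S.N, |S.ell w * S.head z w| := Finset.abs_sum_le_sum_abs _ _
        _ ≤ ∑ _w ∈ badSet S.Ψ S.N, (2 * S.N) * headMax t z := Finset.sum_le_sum fun w _ => by
            rw [abs_mul, abs_of_nonneg (S.ell_nonneg w)]
            exact mul_le_mul (S.ell_le w) (S.abs_head_le hz2 w) (abs_nonneg _) (by positivity)
        _ = #(badSet S.Ψ S.N) * ((2 * S.N) * headMax t z) := by rw [Finset.sum_const, nsmul_eq_mul]
        _ ≤ (t * t * (2 * S.N + 1) ^ (d - 1) : ℕ) * ((2 * S.N) * headMax t z) := by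
            refine mul_le_mul_of_nonneg_right ?_ (by have := headMax_nonneg t hz1; positivity)
            exact_mod_cast hbad
        _ = _ := by ring
    refine (abs_add_sub_le_three _ _ _).trans ?_
    have hH0 := headMax_nonneg t hz1
    calc |∑ w ∈ latticeBox d S.N, (S.cnt w : ℝ) * S.head z w - V * Hb| +
          |∑ w ∈ latticeBox d S.N, (S.ell w - S.cnt w) * S.head z w| +
            |∑ w ∈ badSet S.Ψ S.N, S.ell w * S.head z w|
        ≤ headMax t z * ((primorial z : ℕ) : ℝ) ^ d * (((d : ℝ) + 1) * 4 ^ d * ((2 * S.N : ℕ) : ℝ) ^ d) +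
            ((2 * S.N + 1) ^ d : ℕ) * headMax t z +
              (t * t * (2 * S.N + 1) ^ (d - 1) : ℕ) * (2 * S.N) * headMax t z := add_le_add (add_le_add hequi h2) h3
      _ = _ := by ring
  -- Piece 3
  have hP3 : V * Hb * (Rb - 1) ≤ (2 * (S.N : ℝ)) ^ (d + 1) * headBar t S.L D *
      ((2 * (t : ℝ) ^ 3 / z) * Real.exp (2 * (t : ℝ) ^ 3 / z)) := by
    have h1 : Rb - 1 ≤ (2 * (t : ℝ) ^ 3 / z) * Real.exp (2 * (t : ℝ) ^ 3 / z) :=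
      calc Rb - 1 ≤ Real.exp (2 * (t : ℝ) ^ 3 / z) - 1 := by linarith
        _ ≤ _ := exp_sub_one_le_mul_exp _
    exact mul_le_mul (mul_le_mul S.volume_K_le hHbar hHb0 (by positivity)) h1 (by linarith)
      (by have := headBar_nonneg t S.L D; positivity)
  -- assemble
  have hP1' : 0 ≤ ∑ w ∈ G, S.ell w * S.head z w * (tailR S.Ψ z x w - 1) :=
    Finset.sum_nonneg fun w _ => mul_nonneg (mul_nonneg (S.ell_nonneg w) (S.head_le hz2 w).1)
      (by linarith [one_le_tailR hL ha ht hz x w])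
  have hP3' : 0 ≤ V * Hb * (Rb - 1) := mul_nonneg (mul_nonneg hV0 hHb0) (by linarith)
  rw [hdecomp]
  unfold avgError
  rw [← hD]
  refine mul_le_mul hBle ?_ (abs_nonneg _) (zero_le_one.trans (one_le_tailBound _ _))
  calc |∑ w ∈ G, S.ell w * S.head z w * (tailR S.Ψ z x w - 1) +
          (∑ w ∈ G, S.ell w * S.head z w - V * Hb) - V * Hb * (Rb - 1)|
      ≤ |∑ w ∈ G, S.ell w * S.head z w * (tailR S.Ψ z x w - 1)| +
          |∑ w ∈ G, S.ell w * S.head z w - V * Hb| + |V * Hb * (Rb - 1)| := abs_add_sub_le_three _ _ _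
      _ = _ := by rw [abs_of_nonneg hP1', abs_of_nonneg hP3']
      _ ≤ _ := add_le_add (add_le_add hP1 hP2) hP3

/-- **The averaging lemma** (limit form): the fibre main terms average to the main term of `Ψ`,
`|∑_{w good} ℓ(w) 𝔖(Φ_w) - vol(K) 𝔖(Ψ)| ≤ avgError`. [cite: GreenTao2010, §1 (remark after Conj. 1.2)] -/
theorem abs_fibreMainSum_lim_sub_le :
    |∑ w ∈ goodSet S.Ψ S.N, S.ell w * singularProduct (fibreSystem S.Ψ w) -
        (volume S.K).toReal * singularProduct S.Ψ| ≤ avgError d t S.L S.N z := by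
  have hlim : Tendsto (fun x => ∑ w ∈ goodSet S.Ψ S.N, S.ell w * singularProductPartial (fibreSystem S.Ψ w) x -
      (volume S.K).toReal * singularProductPartial S.Ψ x) atTop
      (𝓝 (∑ w ∈ goodSet S.Ψ S.N, S.ell w * singularProduct (fibreSystem S.Ψ w) -
        (volume S.K).toReal * singularProduct S.Ψ)) := by
    refine Tendsto.sub (tendsto_finsetSum _ fun w hw => Tendsto.const_mul _ ?_) (Tendsto.const_mul _ ?_)
    · exact tendsto_singularProductPartial_holds _ _ _ (isNondegenerateSystem_of_mem_goodSet S.lastCoeff_ne hw)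
    · exact tendsto_singularProductPartial_holds _ _ _ S.nondeg
  refine le_of_tendsto hlim.abs ?_
  filter_upwards [eventually_ge_atTop z] with x hx
  exact S.abs_fibreMainSum_sub_le hz hz2 hNt hx

end Estimate

end FibreSetting

end Summit.Parity.GeneralizedHardyLittlewood.Theorems
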